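import Literature.Computability.Complexity.Hastad3SatDart
import HarnessLib

/-!
# Håstad's E3-CNF with an arbitrary good numbering of the folded table entries

`Hastad3SatAssembly.hastadCNF H k hyp` numbers the folded long-code variables by enumerating the finite
types of table entries (`Fintype.equivFin`).  A machine rendering of the reduction uses its own closed-form
numbering (mixed-radix codes of vertices and bit-mask codes of Boolean functions), so this file restates
the three properties of the CNF for an ARBITRARY numbering `(nA, nB)` that is good in the sense of
`CNFData.GoodNumbering` (injective on each side, disjoint ranges) — the proofs are those of
`Hastad3SatAssembly`/`Hastad3SatDart`, which use nothing else about the numbering: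

* `hastadDataN`, `hastadCNFN`, `isExactWidth_hastadCNFN`, `satisfiable_hastadCNFN`,
  `maxSatFraction_hastadCNFN_le`;
* for the repeated dart game of a regular constraint graph: `hastad_dartN_isExactWidth`,
  `hastad_dartN_satisfiable`, `hastad_dartN_maxSatFraction_le`.

## References

* J. Håstad, *Some optimal inapproximability results*, J. ACM 48 (2001) 798–859, Thm 6.5 and §6.1 [Hastad2001].
* S. Arora, B. Barak, *Computational Complexity: A Modern Approach*, CUP 2009, Claim 22.36 [AroraBarakCC2009].
-/

noncomputable section

namespace Literature.Computability.Complexity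

namespace ProjGame

open Finset Literature.Probability.RandomGraphs.LowDegree Literature.Computability.Complexity.LongCode
  Literature.Computability.Complexity.Hastad3Sat

variable {E V U β α : Type} [Fintype E] [Fintype V] [Fintype U] [Fintype β] [Fintype α]
  [DecidableEq E] [DecidableEq V] [DecidableEq U] [DecidableEq β] [DecidableEq α]

variable (H : ProjGame E V U β α) (k : ℕ) (hyp : HastadHyp H)

/-- **The data of the CNF with a given numbering** `(nA, nB)` of the table entries: `ε = 1/k`, the base
points of `hastadData`, `K⋆ = |β|^L`. [cite: Hastad2001, §6.1 (proof of Thm 6.5)] -/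
def hastadDataN (hk : 0 < k) (nA : BlockU V U (nBlocks k) hyp.v₀ → ((Fin (nBlocks k) → β) × α → Bool) → ℕ)
    (nB : ∀ w : Fin (nBlocks k) → V, ((H.hGame k hyp hk).Lab w → Bool) → ℕ) : (H.hGame k hyp hk).CNFData where
  p := 1
  q := k
  p_le := hk
  xA := fun _ => (fun _ => hyp.lab0 hyp.v₀, hyp.a₀)
  yB := H.baseLab k hyp hk
  nA := nA
  nB := nB
  Kstar := Fintype.card (Fin (nBlocks k) → β)

variable {hk : 0 < k} (nA : BlockU V U (nBlocks k) hyp.v₀ → ((Fin (nBlocks k) → β) × α → Bool) → ℕ)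
  (nB : ∀ w : Fin (nBlocks k) → V, ((H.hGame k hyp hk).Lab w → Bool) → ℕ)

/-- **Håstad's E3-CNF** for the game `H` at precision `k`, with the numbering `(nA, nB)`. [cite: Hastad2001, Thm 6.5] -/
def hastadCNFN : CNF ℕ := (H.hastadDataN k hyp hk nA nB).hCNF

omit [Fintype U] [DecidableEq E] [DecidableEq U] in
/-- **Exact width three** (good numbering). [cite: Hastad2001, Thm 6.5 (E3-CNF)] -/
theorem isExactWidth_hastadCNFN (hN : (H.hastadDataN k hyp hk nA nB).GoodNumbering) :
    (H.hastadCNFN k hyp nA nB).IsExactWidth 3 :=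
  (H.hastadDataN k hyp hk nA nB).isExactWidth_hCNF hN

omit [Fintype U] [DecidableEq E] [DecidableEq U] in
/-- **Completeness** (good numbering): perfect strategies of `H` make the CNF satisfiable.
[cite: Hastad2001, Lemma 6.12 (completeness)] -/
theorem satisfiable_hastadCNFN (hN : (H.hastadDataN k hyp hk nA nB).GoodNumbering) {b : V → β} {a : U → α}
    (hsat : ∀ e, H.proj e (b (H.src e)) = some (a (H.dst e))) : (H.hastadCNFN k hyp nA nB).Satisfiable :=
  (H.hastadDataN k hyp hk nA nB).satisfiable_hCNF hN
    (b := fun w ℓ => b (w ℓ))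
    (a := fun p => (Function.update (fun ℓ => b (p.1.2.1 ℓ)) p.1.1 (hyp.lab0 hyp.v₀), a p.1.2.2))
    (H.block_sat (nBlocks k) (nBlocks_pos k hk) hyp.v₀ (hyp.lab0 hyp.v₀) hsat)

/-- **Soundness** (any numbering): if `val(H) ≤ 1/(4k⁴)` (`k ≥ 8`), every assignment satisfies at most a
fraction `7/8 + 2/k` of the clauses.  (The proof of `maxSatFraction_hastadCNF_le`, which does not use the
numbering.) [cite: Hastad2001, Thm 6.5] -/
theorem maxSatFraction_hastadCNFN_le [Nonempty E] (hk8 : 8 ≤ k) (hval : H.ValLe (1 / (4 * (k : ℝ) ^ 4))) :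
    ((H.hastadCNFN k hyp (hk := hk) nA nB).maxSatFraction : ℝ) ≤ 7 / 8 + 2 / k := by
  have hk0 : 0 < k := hk
  have hkR : (8 : ℝ) ≤ k := by exact_mod_cast hk8
  have hkpos : (0 : ℝ) < k := by linarith
  haveI : Nonempty (Fin (nBlocks k) × (Fin (nBlocks k) → V) × E) :=
    ⟨(⟨0, nBlocks_pos k hk0⟩, fun _ => hyp.v₀, Classical.arbitrary E)⟩
  -- the parameters
  have hε : (H.hastadDataN k hyp hk nA nB).eps = 1 / k := by simp [hastadDataN, CNFData.eps]
  have hθ0 : (0 : ℝ) ≤ 1 / (4 * (k : ℝ) ^ 4) := by positivity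
  -- value and smoothness of the block game
  have hvalM : (H.hGame k hyp hk).ValLe (1 / (4 * (k : ℝ) ^ 4)) := H.block_valLe _ _ _ _ hval
  have hsm : (H.hGame k hyp hk).SmoothAt (4 * k ^ 2) (((4 * k ^ 2 : ℕ) : ℝ) ^ 2 / nBlocks k) :=
    H.block_smoothAt _ _ _ _ hyp.reg (4 * k ^ 2)
  have hξ : (((4 * k ^ 2 : ℕ) : ℝ)) ^ 2 / nBlocks k = 1 / k := by
    unfold nBlocks; push_cast; field_simp; ring
  rw [hξ] at hsm
  -- the acceptance probability of the test on the block game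
  have hτ : ∀ (A : BlockU V U (nBlocks k) hyp.v₀ → ((Fin (nBlocks k) → β) × α → Bool) → Bool)
      (B : ∀ w, ((H.hGame k hyp hk).Lab w → Bool) → Bool), (∀ u, IsFolded (A u)) → (∀ w, IsFolded (B w)) →
      (H.hGame k hyp hk).testAcc (H.hastadDataN k hyp hk nA nB).eps A B ≤ 7 / 8 + 7 / (8 * k) := by
    intro A B hA hB
    have h := (H.hGame k hyp hk).testAcc_soundness (ε := (H.hastadDataN k hyp hk nA nB).eps) (ξ := 1 / k)
      (θ := 1 / (4 * (k : ℝ) ^ 4)) (T := 4 * k ^ 2)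
      (by rw [hε]; positivity) (by rw [hε, div_le_iff₀ hkpos]; linarith) (by positivity) hθ0 hvalM hsm hA hB
    rw [hε] at h ⊢
    have e1 : Real.exp (-(((4 * k ^ 2 : ℕ) : ℝ) * (1 / k)) / 4) ≤ 1 / k := by
      have : -(((4 * k ^ 2 : ℕ) : ℝ) * (1 / k)) / 4 = -k := by push_cast; field_simp
      rw [this]
      exact exp_neg_le_inv hkpos
    have e2 : Real.exp (-(((4 * k ^ 2 : ℕ) : ℝ) * (1 / k)) / 8) ≤ 2 / k := by
      have : -(((4 * k ^ 2 : ℕ) : ℝ) * (1 / k)) / 8 = -(k / 2) := by push_cast; field_simp; ring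
      rw [this]
      refine (exp_neg_le_inv (by positivity)).trans (le_of_eq ?_)
      field_simp
    have e3 : Real.sqrt (((4 * k ^ 2 : ℕ) : ℝ) * (1 / (4 * (k : ℝ) ^ 4))) = 1 / k := by
      push_cast
      rw [show (4 : ℝ) * k ^ 2 * (1 / (4 * k ^ 4)) = (1 / k) ^ 2 by field_simp]
      exact Real.sqrt_sq (by positivity)
    rw [e3] at h
    have : 8 * ((H.hGame k hyp hk).testAcc (1 / k) A B - 7 / 8) ≤ 7 / k := by
      calc 8 * ((H.hGame k hyp hk).testAcc (1 / k) A B - 7 / 8)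
          ≤ 1 / k + Real.exp (-(((4 * k ^ 2 : ℕ) : ℝ) * (1 / k)) / 4) +
            Real.exp (-(((4 * k ^ 2 : ℕ) : ℝ) * (1 / k)) / 8) + 2 * (1 / k) + 1 / k := h
        _ ≤ 1 / k + 1 / k + 2 / k + 2 * (1 / k) + 1 / k := by linarith
        _ = 7 / k := by ring
    have h8 : (H.hGame k hyp hk).testAcc (1 / k) A B ≤ 7 / 8 + 7 / k / 8 := by linarith
    calc (H.hGame k hyp hk).testAcc (1 / k) A B ≤ 7 / 8 + 7 / k / 8 := h8
      _ = 7 / 8 + 7 / (8 * k) := by ring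
  -- the value of the formula
  have hK : ∀ w, Fintype.card ((H.hGame k hyp hk).Lab w) ≤ (H.hastadDataN k hyp hk nA nB).Kstar :=
    fun w => Fintype.card_subtype_le _
  have hr : ∀ e, k ≤ ((univ : Finset ((H.hGame k hyp hk).Lab ((H.hGame k hyp hk).src e))).image
      ((H.hGame k hyp hk).tproj _ (CNFData.edgeAt e))).card := by
    rintro ⟨ℓ, vs, e'⟩
    refine le_trans ?_ (H.card_image_tproj_ge k hyp hk0 ℓ vs e')
    unfold nBlocks
    have : k ≤ 16 * k ^ 5 - 1 := by
      have h1 : k ^ 1 ≤ k ^ 5 := Nat.pow_le_pow_right hk0 (by norm_num)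
      have h2 : 2 * k ≤ 16 * k ^ 5 := by nlinarith
      omega
    exact this
  obtain ⟨σ, hσ⟩ := (H.hastadCNFN k hyp (hk := hk) nA nB).exists_maxSatFraction_eq
  have hτ1 : (7 : ℝ) / 8 + 7 / (8 * k) ≤ 1 := by
    have : (7 : ℝ) / (8 * k) ≤ 7 / 64 := by
      rw [div_le_div_iff₀ (by positivity) (by norm_num)]; nlinarith
    linarith
  have hmain := (H.hastadDataN k hyp hk nA nB).satisfiedFraction_hCNF_le (fun e => by simp [hGame, block_wt, hyp.unit]) hk0
    (by show 4 * 1 ≤ k; omega) hK (r := k) (by omega) hr (τ := 7 / 8 + 7 / (8 * k)) hτ1 hτ σ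
  unfold hastadCNFN at hσ ⊢
  rw [hσ]
  refine hmain.2.trans ?_
  have h2k := two_div_two_pow_le k (by omega)
  have : (7 : ℝ) / (8 * k) + 1 / k ≤ 2 / k := by
    rw [div_add_div _ _ (by positivity) hkpos.ne', div_le_div_iff₀ (by positivity) hkpos]
    nlinarith
  linarith

end ProjGame

/-! ### The repeated dart game of a regular constraint graph -/

namespace Expander

namespace RotGraph

open ProjGame Finset

variable {n d : ℕ} (G : RotGraph n d) (C : Fin n → Fin d → ℕ → ℕ → Bool) (W : ℕ) (hd : 0 < d)
  (acc : Fin n → Fin d → ℕ × ℕ)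
  (hacc : ∀ v i, (acc v i).1 < W ∧ (acc v i).2 < W ∧ C v i (acc v i).1 (acc v i).2 = true)
  (hn : 0 < n) (T' : ℕ) (hT' : 0 < T') (k : ℕ) {hk : 0 < k}
  (nA : BlockU (NProd (Fin n × Fin d) T') (NProd (Fin n) T') (nBlocks k) (G.dartHyp C W hd acc hacc hn T' hT').v₀ →
    ((Fin (nBlocks k) → NProd (Fin (2 * W) × Fin (2 * W)) T') × NProd (Fin (2 * W)) T' → Bool) → ℕ)
  (nB : ∀ w : Fin (nBlocks k) → NProd (Fin n × Fin d) T',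
    ((((G.dartGame2 C W hd).pow T').hGame k (G.dartHyp C W hd acc hacc hn T' hT') hk).Lab w → Bool) → ℕ)

/-- **Exact width three** (good numbering). [cite: Hastad2001, Thm 6.5] -/
theorem hastad_dartN_isExactWidth
    (hN : (((G.dartGame2 C W hd).pow T').hastadDataN k (G.dartHyp C W hd acc hacc hn T' hT') hk nA nB).GoodNumbering) :
    (((G.dartGame2 C W hd).pow T').hastadCNFN k (G.dartHyp C W hd acc hacc hn T' hT') nA nB).IsExactWidth 3 :=
  ProjGame.isExactWidth_hastadCNFN _ k _ nA nB hN

/-- **Completeness** (good numbering): a satisfying assignment of `(G, C)` with values `< W` makes the CNF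
satisfiable. [cite: Hastad2001, Thm 6.5 (satisfiable E3-CNF formulas)] -/
theorem hastad_dartN_satisfiable
    (hN : (((G.dartGame2 C W hd).pow T').hastadDataN k (G.dartHyp C W hd acc hacc hn T' hT') hk nA nB).GoodNumbering)
    {σ : Fin n → ℕ} (hσ : ∀ u, σ u < W) (hsat : ∀ v i, C v i (σ v) (σ (G.nbr v i)) = true) :
    (((G.dartGame2 C W hd).pow T').hastadCNFN k (G.dartHyp C W hd acc hacc hn T' hT') nA nB).Satisfiable := by
  obtain ⟨hσ2, hsat2⟩ := G.dbl_sat C W hσ hsat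
  obtain ⟨b, a, hba⟩ := G.dartGame_pow_sat (dbl C) (2 * W) (fun (_ : Fin n × Fin d) (p : Fin (2 * W) × Fin (2 * W)) => p) hd
    (fun δ p _ => ⟨p, rfl⟩) hσ2 hsat2 T'
  exact ProjGame.satisfiable_hastadCNFN _ k _ nA nB hN hba

/-- **Soundness** (any numbering): `λ(G) ≤ λ < 1`, dart gap `ε ∈ (0, 2]`, `k ≥ 8` and enough repetitions give
value `≤ 7/8 + 2/k`. [cite: Hastad2001, Thm 6.5] -/
theorem hastad_dartN_maxSatFraction_le (hk8 : 8 ≤ k) {lam ε : ℝ} (hlam : SpectralBound G.walkMatrix lam)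
    (hlam1 : lam < 1) (hε2 : ε ≤ 2)
    (hε : ∀ σ : Fin n → ℕ, (∀ u, σ u < W) →
      ε * (n * d) ≤ ((univ.filter fun x : Fin n × Fin d => C x.1 x.2 (σ x.1) (σ (G.nbr x.1 x.2)) = false).card : ℝ))
    (hT'k : Real.sqrt (1 - ProjGame.dsEps ((1 - lam) / 2) (ε / 2)) ^ T' ≤ 1 / (4 * (k : ℝ) ^ 4)) :
    ((((G.dartGame2 C W hd).pow T').hastadCNFN k (G.dartHyp C W hd acc hacc hn T' hT') (hk := hk) nA nB).maxSatFraction : ℝ) ≤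
      7 / 8 + 2 / k := by
  haveI := nonempty_dartEdge hn hd
  have hval := G.dartGame_pow_valLe (dbl C) (2 * W) (fun (_ : Fin n × Fin d) (p : Fin (2 * W) × Fin (2 * W)) => p) hd hn
    hlam hlam1 hε2 (G.dbl_gap C W hε) T'
  exact ProjGame.maxSatFraction_hastadCNFN_le _ k _ nA nB hk8 (hval.mono hT'k)

end RotGraph

end Expander

end Literature.Computability.Complexity

end
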